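import Summits.RiemannHypothesis.RiemannHypothesis.Theorems.MotivicDoorDecreeOffDiagonal
import HarnessLib

/-!
# Motivic door (Connes–Consani): the decreed pairing is not symmetric; symmetrisation; the `¼` law

Honest framing (cell `pub-rhdoor`, cc-3, verbatim): "lottery ticket at the motivic door; RH
probability negligible; consolation prizes are real: a new semi-local Weil-positivity theorem, or a
located gap in the Connes–Consani programme, plus the ff-door theorem".  No RH content below;
value = theorem (a located-gap item: the SYMMETRY of the decreed intersection pairing).

Connes–Consani (arXiv:1805.10501 §3.1) decree `D • D' := ⟨D ⋆ D̃', Δ⟩`, on test functions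
`𝔰(f, g) := N(f ⋆ g̃)` (Connes, arXiv:1509.05576 eq. (17)–(18)), and use it only on the diagonal
(criterion (15): `RH ⟺ 𝔰(f,f) ≤ 0` on the degree/codegree-zero subspace).  An intersection pairing
of divisors on a surface is symmetric.  With the transport of `MotivicDoorDecreeOffDiagonal`
(`𝔰(f,g) = N(toMul κ)`, `𝔰(g,f) = N(toMul κ(−·))`, `κ = u ⋆ w̃` the cross-correlation of the
additive pictures `u, w` of `f, g`) this file records, RH-free:

PROVED:
* `ccN_toMul_add_ccN_toMul_comp_neg`: for every real Weil test `κ`,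
  `N(toMul κ) + N(toMul κ(−·)) = Re Σ_Λ(κ) − Re W_ℝ^{Bombieri}(κ)`
  (`summable_vonMangoldt_mul_toMul`, `re_weilPrimeTerm_ofReal_eq_add`,
  `weilArchTermBombieri_ofReal`); hence the SYMMETRISATION
  IDENTITY `ccPairing_add_ccPairing_swap`: `𝔰(f,g) + 𝔰(g,f) = Re Σ_Λ(u ⋆ w̃) − Re W_ℝ(u ⋆ w̃)`
  `= Re(polar term) − Re W(u ⋆ w̃)` (`…_eq_polar_sub_weilFunctional`), which for `u = w` is the
  tree's `two_mul_ccPairing_toMul_eq`.  Only the symmetrised pairing `½(𝔰(f,g) + 𝔰(g,f))` is an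
  explicit-formula (Weil) functional of `f ⋆ g̃`; it agrees with `𝔰` on the diagonal, so criterion
  (15) is unaffected.
* `ccPairing_toMul_swap_eq_zero`: if `supp u ⊆ [a₁, b₁]` lies strictly to the right of
  `supp w ⊆ [a₂, b₂]` (`b₂ < a₁`) then `𝔰(g, f) = 0` EXACTLY (`g ⋆ f̃` lives on `u < 1`, which `N`
  does not charge).
* `massDstar_crossCorr_eq_mul`: `∫ (f ⋆ g̃) d^*u = ∫ f d^*u · ∫ g du` (Mellin multiplicativity);
  `massDstar_mul_massDu_le_ccPairing`: if moreover `b₁ − a₂ < log 2` and `u, w ≥ 0` then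
  `𝔰(f, g) ≥ ∫ f d^*u · ∫ g du`, `> 0` when `u, w ≢ 0` (`ccPairing_toMul_pos`): `f ⋆ g̃ = toMul κ`,
  `κ ≥ 0` supported in `(0, log 2)`, where no prime power lives and `N ≥ ∫ · d^*u`.
* `exists_ccPairing_toMul_ne_symm`: **the decree as printed is not symmetric** — there are smooth
  compactly supported `f, g` on `ℝ₊^*` with `𝔰(g, f) = 0 < 𝔰(f, g)` (bumps of radius `(log 2)/8` at
  `0` and `(log 2)/2`).  No zeros of `ζ` and no primes enter: the window `(0, log 2)`.
* `abs_re_weilQuadratic_weilDilate_sub_log_le_quarter`: the diagonal window law of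
  `MotivicDoorDiagonalAsymptotics` (ii) with the sharp residual constant
  (`norm_archResidual_comp_mul_le_quarter`, `|k_r| ≤ ½`):
  `|Re Q(g_η) − ‖g‖₂² log(1+η) − (½Re 𝓔(g ⋆ g̃) − log(2π)‖g‖₂²)| ≤ (16R‖g‖₂² + ¼∫₀^∞‖k‖)/(1+η)`.

DERIVED reading (for the referees' located-gap list, not a claim about the programme's intent):
the symmetric bilinear form extending the diagonal decree is the polarisation
`½(𝔰(f,g) + 𝔰(g,f)) = ½(Re Σ_Λ − Re W_ℝ)(u ⋆ w̃)`, not `N(f ⋆ g̃)` itself.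

References: Bombieri 2000 (Thm 2); Weil 1952; Connes, arXiv:1509.05576 §3.1 eq. (17)–(18);
Connes–Consani, arXiv:1805.10501 §3.1 eq. (15)–(17).
-/

noncomputable section

set_option linter.dupNamespace false

open Complex Set MeasureTheory Filter Topology Literature.NumberTheory.LFunctions
open Literature.NumberTheory.ConnesConsani2019
open Summit.RiemannHypothesis.RiemannHypothesis.Theorems.MotivicDoor.ArchLogLaplacian
open scoped Real ComplexConjugate ArithmeticFunction.vonMangoldt

namespace Summit.RiemannHypothesis.RiemannHypothesis.Theorems.MotivicDoor.ConnesConsani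

/-! ## 1. Symmetrisation: `𝔰(f, g) + 𝔰(g, f)` is an explicit-formula functional of `f ⋆ g̃` -/

section Symmetrisation

variable {κ : ℝ → ℝ}

/-- The prime sum of `N(toMul κ)` is a finite sum.  PROVED. -/
theorem summable_vonMangoldt_mul_toMul (hκ : IsWeilTest fun t ↦ (κ t : ℂ)) :
    Summable fun n : ℕ ↦ Λ n * toMul κ n := by
  obtain ⟨R, hR⟩ := hκ.2.isCompact.isBounded.subset_closedBall 0
  refine summable_of_ne_finset_zero (s := Finset.range ⌈Real.exp (|R| + 1)⌉₊) fun n hn ↦ ?_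
  rw [Finset.mem_range, not_lt] at hn
  have hn' : Real.exp (|R| + 1) ≤ n := (Nat.le_ceil _).trans (by exact_mod_cast hn)
  have hpos : (0 : ℝ) < n := (Real.exp_pos _).trans_le hn'
  have hlog : |R| + 1 ≤ Real.log n := by rwa [Real.le_log_iff_exp_le hpos]
  have h0 : ∀ x : ℝ, |R| < |x| → κ x = 0 := fun x hx ↦ by
    have h := image_eq_zero_of_notMem_tsupport (f := fun t ↦ (κ t : ℂ)) (x := x) fun hxs ↦ by
      have hxR := hR hxs
      rw [Metric.mem_closedBall, dist_zero_right, Real.norm_eq_abs] at hxR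
      linarith [le_abs_self R]
    exact_mod_cast h
  have h1 : |R| < |Real.log n| := lt_of_lt_of_le (by linarith) (le_abs_self _)
  have hn0 : 0 < n := by exact_mod_cast hpos
  show Λ n * toMul κ n = 0
  rw [toMul_natCast κ hn0, h0 _ h1, zero_div, mul_zero]

/-- **Prime side**: `Re Σ_Λ(κ) = Σ Λ(n) n^{-1/2} κ(log n) + Σ Λ(n) n^{-1/2} κ(−log n)`, i.e. the
prime sums of `N(toMul κ)` and `N(toMul κ(−·))` add up to Weil's prime term of `κ`.  PROVED. -/
theorem re_weilPrimeTerm_ofReal_eq_add (hκ : IsWeilTest fun t ↦ (κ t : ℂ)) :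
    (weilPrimeTerm fun t ↦ (κ t : ℂ)).re =
      (∑' n : ℕ, Λ n * toMul κ n) + ∑' n : ℕ, Λ n * toMul (fun t ↦ κ (-t)) n := by
  have hκ' : IsWeilTest fun t ↦ ((κ (-t) : ℝ) : ℂ) := by
    have h := hκ.weilReflect
    have e : weilReflect (fun t ↦ (κ t : ℂ)) = fun t ↦ ((κ (-t) : ℝ) : ℂ) := by
      funext t; simp [weilReflect]
    rwa [e] at h
  rw [weilPrimeTerm, Complex.re_tsum (summable_weilPrimeTerm hκ.2),
    ← (summable_vonMangoldt_mul_toMul hκ).tsum_add (summable_vonMangoldt_mul_toMul hκ')]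
  refine tsum_congr fun n ↦ ?_
  rcases Nat.eq_zero_or_pos n with rfl | hn
  · simp
  · have h1 : ((Λ n : ℝ) : ℂ) / (Real.sqrt n : ℂ) = (((Λ n) / Real.sqrt n : ℝ) : ℂ) := by
      push_cast; rfl
    have h2 : toMul (fun t ↦ κ (-t)) n = κ (-Real.log n) / Real.sqrt n := toMul_natCast _ hn
    rw [h1, Complex.re_ofReal_mul, Complex.add_re, Complex.ofReal_re, Complex.ofReal_re,
      toMul_natCast _ hn, h2]
    ring

/-- **Archimedean side** (Bombieri's form, real `κ`): `W_ℝ(κ)` is the real number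
`−(log 4π + γ)κ(0) − ∫₀^∞ (e^{t/2}(κ(t) + κ(−t)) − 2κ(0))/(2 sinh t) dt`.  PROVED. -/
theorem weilArchTermBombieri_ofReal (κ : ℝ → ℝ) :
    weilArchTermBombieri (fun t ↦ (κ t : ℂ)) =
      ((-((Real.log (4 * π) + Real.eulerMascheroniConstant) * κ 0 +
          ∫ t in Ioi (0 : ℝ), (Real.exp (t / 2) * (κ t + κ (-t)) - 2 * κ 0) / (2 * Real.sinh t)) :
        ℝ) : ℂ) := by
  have e : ∀ t : ℝ, ((Real.exp (t / 2) : ℂ) * ((κ t : ℂ) + (κ (-t) : ℂ)) - 2 * (κ 0 : ℂ)) /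
      (2 * Real.sinh t : ℂ) =
      (((Real.exp (t / 2) * (κ t + κ (-t)) - 2 * κ 0) / (2 * Real.sinh t) : ℝ) : ℂ) := by
    intro t; push_cast; ring
  rw [weilArchTermBombieri_eq]
  simp_rw [e]
  rw [integral_complex_ofReal]
  push_cast
  ring

/-- **Symmetrisation of `N` on the additive side**: for every real test `κ`,
`N(toMul κ) + N(toMul κ(−·)) = Re Σ_Λ(κ) − Re W_ℝ^{Bombieri}(κ)` — the tree's normalisation theorem
`two_mul_ccN_toMul_eq` is the even case `κ(−·) = κ`.  PROVED. -/
theorem ccN_toMul_add_ccN_toMul_comp_neg (hκ : IsWeilTest fun t ↦ (κ t : ℂ)) :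
    ccN (toMul κ) + ccN (toMul fun t ↦ κ (-t)) =
      (weilPrimeTerm fun t ↦ (κ t : ℂ)).re - (weilArchTermBombieri fun t ↦ (κ t : ℂ)).re := by
  have hκ' : IsWeilTest fun t ↦ ((κ (-t) : ℝ) : ℂ) := by
    have h := hκ.weilReflect
    have e : weilReflect (fun t ↦ (κ t : ℂ)) = fun t ↦ ((κ (-t) : ℝ) : ℂ) := by
      funext t; simp [weilReflect]
    rwa [e] at h
  have hA1 := integrableOn_ccArchIntegrand κ hκ
  have hA2 : IntegrableOn (fun t ↦ (Real.exp (t / 2) * (2 * κ (-t)) - 2 * κ 0) / (2 * Real.sinh t))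
      (Ioi 0) := by
    simpa only [neg_zero] using integrableOn_ccArchIntegrand (fun t ↦ κ (-t)) hκ'
  have hB : IntegrableOn (fun t : ℝ ↦ 2 * κ 0 / (Real.exp t + 1)) (Ioi 0) :=
    integrableOn_const_div_exp_add_one _
  have hlog : ∫ t in Ioi (0 : ℝ), 2 * κ 0 / (Real.exp t + 1) = 2 * κ 0 * Real.log 2 := by
    rw [← integral_Ioi_one_div_exp_add_one, ← integral_const_mul]
    refine setIntegral_congr_fun measurableSet_Ioi fun t _ ↦ ?_
    ring
  have h1 := two_mul_ccN_toMul κ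
  have h2 : 2 * ccN (toMul fun t ↦ κ (-t)) = 2 * (∑' n : ℕ, Λ n * toMul (fun t ↦ κ (-t)) n) +
      (∫ t in Ioi (0 : ℝ), ((Real.exp (t / 2) * (2 * κ (-t)) - 2 * κ 0) / (2 * Real.sinh t) +
        2 * κ 0 / (Real.exp t + 1))) + (Real.log π + Real.eulerMascheroniConstant) * κ 0 := by
    simpa only [neg_zero] using two_mul_ccN_toMul (fun t ↦ κ (-t))
  rw [integral_add hA1 hB, hlog] at h1
  rw [integral_add hA2 hB, hlog] at h2
  have hsum : (∫ t in Ioi (0 : ℝ), (Real.exp (t / 2) * (2 * κ t) - 2 * κ 0) / (2 * Real.sinh t)) +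
      (∫ t in Ioi (0 : ℝ), (Real.exp (t / 2) * (2 * κ (-t)) - 2 * κ 0) / (2 * Real.sinh t)) =
      2 * ∫ t in Ioi (0 : ℝ),
        (Real.exp (t / 2) * (κ t + κ (-t)) - 2 * κ 0) / (2 * Real.sinh t) := by
    rw [← integral_add hA1 hA2, ← integral_const_mul]
    refine setIntegral_congr_fun measurableSet_Ioi fun t _ ↦ ?_
    ring
  have hP := re_weilPrimeTerm_ofReal_eq_add hκ
  have hW := congrArg Complex.re (weilArchTermBombieri_ofReal κ)
  rw [Complex.ofReal_re] at hW
  have h4 : Real.log (4 * π) = 2 * Real.log 2 + Real.log π := by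
    rw [show (4 : ℝ) * π = 2 * 2 * π by ring, Real.log_mul (by norm_num) Real.pi_pos.ne',
      Real.log_mul two_ne_zero two_ne_zero]
    ring
  linear_combination (1 / 2 : ℝ) * h1 + (1 / 2 : ℝ) * h2 + (1 / 2 : ℝ) * hsum - hP + hW - κ 0 * h4

variable {u w : ℝ → ℝ}

/-- **The symmetrised decree**: for `f = toMul u`, `g = toMul w` (`u, w` real Weil tests) and
`k = u ⋆ w̃` their cross-correlation, `𝔰(f, g) + 𝔰(g, f) = Re Σ_Λ(k) − Re W_ℝ(k)`; with `u = w`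
this is `two_mul_ccPairing_toMul_eq`.  PROVED. -/
theorem ccPairing_add_ccPairing_swap (hu : IsWeilTest fun t ↦ (u t : ℂ))
    (hw : IsWeilTest fun t ↦ (w t : ℂ)) :
    ccPairing (toMul u) (toMul w) + ccPairing (toMul w) (toMul u) =
      (weilPrimeTerm (weilConv (fun t ↦ (u t : ℂ)) (weilReflect fun t ↦ (w t : ℂ)))).re -
        (weilArchTerm (weilConv (fun t ↦ (u t : ℂ)) (weilReflect fun t ↦ (w t : ℂ)))).re := by
  have hκ := isWeilTest_crossCorr hu hw
  have e : weilConv (fun s ↦ (u s : ℂ)) (weilReflect fun s ↦ (w s : ℂ)) =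
      fun t ↦ ((∫ s, u s * w (s - t) : ℝ) : ℂ) :=
    funext (weilConv_ofReal_weilReflect_ofReal u w)
  rw [ccPairing_toMul_toMul, ccPairing_toMul_toMul_swap, e,
    ← weilArchTermBombieri_eq_weilArchTerm_holds hκ]
  exact ccN_toMul_add_ccN_toMul_comp_neg hκ

/-- Equivalently `𝔰(f, g) + 𝔰(g, f) = Re(polar term of k) − Re W(k)`, `W` = Weil's functional.
PROVED. -/
theorem ccPairing_add_ccPairing_swap_eq_polar_sub_weilFunctional (hu : IsWeilTest fun t ↦ (u t : ℂ))
    (hw : IsWeilTest fun t ↦ (w t : ℂ)) :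
    ccPairing (toMul u) (toMul w) + ccPairing (toMul w) (toMul u) =
      (weilPolarTerm (weilConv (fun t ↦ (u t : ℂ)) (weilReflect fun t ↦ (w t : ℂ)))).re -
        (weilFunctional (weilConv (fun t ↦ (u t : ℂ)) (weilReflect fun t ↦ (w t : ℂ)))).re := by
  rw [ccPairing_add_ccPairing_swap hu hw, weilFunctional, Complex.add_re, Complex.sub_re]
  ring

/-- **The polar term of the cross-correlation is the bidegree cross term**:
`P(u ⋆ w̃) = ∫f d^*u · ∫g du + ∫f du · ∫g d^*u` (`f = toMul u`, `g = toMul w`; Mellin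
multiplicativity at `s = 0, 1`).  PROVED. -/
theorem weilPolarTerm_crossCorr (hu : IsWeilTest fun t ↦ (u t : ℂ))
    (hw : IsWeilTest fun t ↦ (w t : ℂ)) :
    weilPolarTerm (weilConv (fun t ↦ (u t : ℂ)) (weilReflect fun t ↦ (w t : ℂ))) =
      ((massDstar (toMul u) * massDu (toMul w) + massDu (toMul u) * massDstar (toMul w) : ℝ) :
        ℂ) := by
  have hw' := hw.weilReflect
  rw [weilPolarTerm, weilMellin_weilConv_holds hu.1.continuous hu.2 hw'.1.continuous hw'.2,
    weilMellin_weilConv_holds hu.1.continuous hu.2 hw'.1.continuous hw'.2,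
    weilMellin_weilReflect_holds, weilMellin_weilReflect_holds, map_zero, map_one, sub_zero,
    sub_self, weilMellin_zero_eq_massDstar u, weilMellin_zero_eq_massDstar w,
    weilMellin_one_eq_massDu u, weilMellin_one_eq_massDu w, Complex.conj_ofReal,
    Complex.conj_ofReal]
  push_cast
  ring

/-- **The polarised dictionary**:
`𝔰(f,g) + 𝔰(g,f) = ∫f d^*u · ∫g du + ∫f du · ∫g d^*u − Re W(u ⋆ w̃)`; for `u = w` this is the
diagonal dictionary `2𝔰(f,f) = 2ĝ(0)ĝ(1) − Re Q(g)` (`two_mul_ccPairing_toMul_eq` with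
`weilPoleForm_ofReal_eq_two_mul_massDstar_mul_massDu`).  PROVED. -/
theorem ccPairing_add_ccPairing_swap_eq_masses_sub_weilFunctional
    (hu : IsWeilTest fun t ↦ (u t : ℂ)) (hw : IsWeilTest fun t ↦ (w t : ℂ)) :
    ccPairing (toMul u) (toMul w) + ccPairing (toMul w) (toMul u) =
      massDstar (toMul u) * massDu (toMul w) + massDu (toMul u) * massDstar (toMul w) -
        (weilFunctional (weilConv (fun t ↦ (u t : ℂ)) (weilReflect fun t ↦ (w t : ℂ)))).re := by
  rw [ccPairing_add_ccPairing_swap_eq_polar_sub_weilFunctional hu hw, weilPolarTerm_crossCorr hu hw,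
    Complex.ofReal_re]

end Symmetrisation

/-! ## 2. The decree is not symmetric -/

section Asymmetry

variable {u w : ℝ → ℝ}

/-- **`𝔰(g, f) = 0`** when `supp u` lies strictly to the right of `supp w` (`f = toMul u`,
`g = toMul w`): then `κ_{u,w}` lives on `t > 0`, `g ⋆ f̃ = toMul κ_{u,w}(−·)` lives on `(0, 1)`, and
`N` does not see it.  PROVED. -/
theorem ccPairing_toMul_swap_eq_zero (hu : IsWeilTest fun t ↦ (u t : ℂ)) {a₁ b₁ a₂ b₂ : ℝ}
    (hsu : tsupport (fun t ↦ (u t : ℂ)) ⊆ Icc a₁ b₁)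
    (hsw : tsupport (fun t ↦ (w t : ℂ)) ⊆ Icc a₂ b₂)
    (hsep : b₂ < a₁) : ccPairing (toMul w) (toMul u) = 0 := by
  rw [ccPairing_toMul_toMul_swap u w]
  refine ccN_toMul_eq_zero_of_forall _ fun t ht ↦ ?_
  exact crossCorr_eq_zero_of_windows hu hsu hsw (Or.inl (by linarith))

/-- **`∫ (f ⋆ g̃) d^*u = ∫ f d^*u · ∫ g du`** for `f = toMul u`, `g = toMul w`: Mellin
multiplicativity at `s = 0` (`M(u ⋆ w̃)(0) = Mu(0) · conj Mw(1)`).  PROVED. -/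
theorem massDstar_crossCorr_eq_mul (hu : IsWeilTest fun t ↦ (u t : ℂ))
    (hw : IsWeilTest fun t ↦ (w t : ℂ)) :
    massDstar (toMul fun t ↦ ∫ s, u s * w (s - t)) = massDstar (toMul u) * massDu (toMul w) := by
  have e : (fun t ↦ ((∫ s, u s * w (s - t) : ℝ) : ℂ)) =
      weilConv (fun s ↦ (u s : ℂ)) (weilReflect fun s ↦ (w s : ℂ)) :=
    funext fun t ↦ (weilConv_ofReal_weilReflect_ofReal u w t).symm
  have hw' := hw.weilReflect
  have h : weilMellin (weilConv (fun s ↦ (u s : ℂ)) (weilReflect fun s ↦ (w s : ℂ))) 0 =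
      ((massDstar (toMul fun t ↦ ∫ s, u s * w (s - t)) : ℝ) : ℂ) := by
    rw [← e]
    exact weilMellin_zero_eq_massDstar _
  rw [weilMellin_weilConv_holds hu.1.continuous hu.2 hw'.1.continuous hw'.2,
    weilMellin_weilReflect_holds, map_zero, sub_zero, weilMellin_zero_eq_massDstar,
    weilMellin_one_eq_massDu, Complex.conj_ofReal] at h
  exact_mod_cast h.symm

/-- **`𝔰(f, g) ≥ ∫ f d^*u · ∫ g du`** for nonnegative `u, w` (`f = toMul u`, `g = toMul w`) with
`supp u ⊆ [a₁, b₁]`, `supp w ⊆ [a₂, b₂]`, `b₂ < a₁`, `b₁ − a₂ < log 2`: then `f ⋆ g̃ = toMul κ` with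
`0 ≤ κ` supported in `(0, log 2)`, where `N ≥ ∫ · d^*u`.  PROVED. -/
theorem massDstar_mul_massDu_le_ccPairing (hu : IsWeilTest fun t ↦ (u t : ℂ))
    (hw : IsWeilTest fun t ↦ (w t : ℂ)) (hu0 : ∀ t, 0 ≤ u t) (hw0 : ∀ t, 0 ≤ w t) {a₁ b₁ a₂ b₂ : ℝ}
    (hsu : tsupport (fun t ↦ (u t : ℂ)) ⊆ Icc a₁ b₁)
    (hsw : tsupport (fun t ↦ (w t : ℂ)) ⊆ Icc a₂ b₂)
    (hsep : b₂ < a₁) (hlog : b₁ - a₂ < Real.log 2) :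
    massDstar (toMul u) * massDu (toMul w) ≤ ccPairing (toMul u) (toMul w) := by
  have hκ := isWeilTest_crossCorr hu hw
  have hnn : ∀ t, 0 ≤ ∫ s, u s * w (s - t) := fun t ↦
    integral_nonneg fun s ↦ mul_nonneg (hu0 s) (hw0 _)
  have h0 : ∀ t, t ≤ 0 → ∫ s, u s * w (s - t) = 0 := fun t ht ↦
    crossCorr_eq_zero_of_windows hu hsu hsw (Or.inl (by linarith))
  have h2 : ∀ t, Real.log 2 ≤ t → ∫ s, u s * w (s - t) = 0 := fun t ht ↦
    crossCorr_eq_zero_of_windows hu hsu hsw (Or.inr (by linarith))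
  rw [ccPairing_toMul_toMul u w, ← massDstar_crossCorr_eq_mul hu hw]
  exact massDstar_toMul_le_ccN _ hκ hnn h0 h2

/-- … hence **`𝔰(f, g) > 0`** as soon as `u, w ≢ 0`.  PROVED. -/
theorem ccPairing_toMul_pos (hu : IsWeilTest fun t ↦ (u t : ℂ)) (hw : IsWeilTest fun t ↦ (w t : ℂ))
    (hu0 : ∀ t, 0 ≤ u t) (hw0 : ∀ t, 0 ≤ w t) {a₁ b₁ a₂ b₂ : ℝ}
    (hsu : tsupport (fun t ↦ (u t : ℂ)) ⊆ Icc a₁ b₁)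
    (hsw : tsupport (fun t ↦ (w t : ℂ)) ⊆ Icc a₂ b₂)
    (hsep : b₂ < a₁) (hlog : b₁ - a₂ < Real.log 2) {s₀ r₀ : ℝ} (hs₀ : u s₀ ≠ 0) (hr₀ : w r₀ ≠ 0) :
    0 < ccPairing (toMul u) (toMul w) :=
  (mul_pos (massDstar_toMul_pos u hu hu0 hs₀) (massDu_toMul_pos w hw hw0 hr₀)).trans_le
    (massDstar_mul_massDu_le_ccPairing hu hw hu0 hw0 hsu hsw hsep hlog)

/-- **The decreed pairing `𝔰(f, g) := N(f ⋆ g̃)` (CC 2019 (15)–(17), Essay (17)–(18)) is not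
symmetric**: there are `f = toMul u`, `g = toMul w` in CC's test class (`u, w` smooth bumps) with
`𝔰(g, f) = 0 < 𝔰(f, g)`.  PROVED (no zeros of `ζ`, no primes: the window `(0, log 2)`). -/
theorem exists_ccPairing_toMul_ne_symm :
    ∃ u w : ℝ → ℝ, IsWeilTest (fun t ↦ (u t : ℂ)) ∧ IsWeilTest (fun t ↦ (w t : ℂ)) ∧
      ccPairing (toMul w) (toMul u) = 0 ∧ 0 < ccPairing (toMul u) (toMul w) := by
  have hL : 0 < Real.log 2 := Real.log_pos one_lt_two
  set L := Real.log 2 with hLdef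
  let bu : ContDiffBump (L / 2) := ⟨L / 16, L / 8, by positivity, by linarith⟩
  let bw : ContDiffBump (0 : ℝ) := ⟨L / 16, L / 8, by positivity, by linarith⟩
  have hWT : ∀ {c : ℝ} (b : ContDiffBump c), IsWeilTest fun t ↦ ((b t : ℝ) : ℂ) := fun b ↦
    ⟨Complex.ofRealCLM.contDiff.comp b.contDiff, b.hasCompactSupport.comp_left Complex.ofReal_zero⟩
  have hsupp : ∀ {c : ℝ} (b : ContDiffBump c),
      tsupport (fun t ↦ ((b t : ℝ) : ℂ)) ⊆ Icc (c - b.rOut) (c + b.rOut) := fun {c} b ↦ by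
    rw [← Real.closedBall_eq_Icc, ← b.tsupport_eq]
    exact closure_mono fun x hx ↦ by simpa [Function.mem_support] using hx
  refine ⟨bu, bw, hWT bu, hWT bw, ?_, ?_⟩
  · refine ccPairing_toMul_swap_eq_zero (hWT bu) (hsupp bu) (hsupp bw) ?_
    show 0 + L / 8 < L / 2 - L / 8
    linarith
  · refine ccPairing_toMul_pos (hWT bu) (hWT bw) (fun t ↦ bu.nonneg) (fun t ↦ bw.nonneg)
      (hsupp bu) (hsupp bw) ?_ ?_ (s₀ := L / 2) (r₀ := 0) ?_ ?_
    · show 0 + L / 8 < L / 2 - L / 8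
      linarith
    · show L / 2 + L / 8 - (0 - L / 8) < Real.log 2
      linarith
    · rw [bu.one_of_mem_closedBall (Metric.mem_closedBall_self bu.rIn_pos.le)]; exact one_ne_zero
    · rw [bw.one_of_mem_closedBall (Metric.mem_closedBall_self bw.rIn_pos.le)]; exact one_ne_zero

end Asymmetry

/-! ## 3. The diagonal window law with the sharp residual constant `¼` -/

section Dilates

variable {g : ℝ → ℂ}

/-- `|Re Q(g_η) − ‖g‖₂² log(1+η) − (½Re 𝓔(F) − log(2π)‖g‖₂²)| ≤ (16R‖g‖₂² + ¼∫₀^∞‖k‖)/(1+η)`;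
sharpens the `5/2` of `abs_re_weilQuadratic_weilDilate_sub_log_le` (`|k_r| ≤ ½`,
`norm_archResidual_comp_mul_le_quarter`).  PROVED. -/
theorem abs_re_weilQuadratic_weilDilate_sub_log_le_quarter (hg : IsWeilTest g) {R : ℝ} (hR : 0 < R)
    (hsupp : tsupport g ⊆ Icc (-R) R) {η : ℝ} (hη : -1 < η) (hRη : R ≤ 1 + η)
    (hRη' : 2 * R ≤ Real.log 2 * (1 + η)) :
    |(weilQuadratic (weilDilate η g)).re - (∫ t, ‖g t‖ ^ 2) * Real.log (1 + η) -
        (1 / 2 * (logLaplacianEnergy (weilConv g (weilReflect g))).re -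
          Real.log (2 * Real.pi) * ∫ t, ‖g t‖ ^ 2)| ≤
      (16 * R * (∫ t, ‖g t‖ ^ 2) +
          1 / 4 * ∫ x in Ioi (0 : ℝ), ‖weilSymm (weilConv g (weilReflect g)) x‖) / (1 + η) := by
  have hc : 0 < 1 + η := by linarith
  have hF : IsWeilTest (weilConv g (weilReflect g)) := hg.weilConv hg.weilReflect
  rw [re_weilQuadratic_weilDilate_eq_logLaplacian hg hη,
    weilPrimeTerm_dilate_eq_zero hg hη hsupp hRη', Complex.zero_re, sub_zero]
  have hP := abs_re_weilPolarTerm_dilate_le hg hR hη hsupp hRη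
  have hRes := norm_archResidual_comp_mul_le_quarter hF hc (F := weilConv g (weilReflect g))
  have hRes' := (Complex.abs_re_le_norm _).trans hRes
  rw [abs_le] at hP hRes' ⊢
  have e : (16 * R * (∫ t, ‖g t‖ ^ 2) +
      1 / 4 * ∫ x in Ioi (0 : ℝ), ‖weilSymm (weilConv g (weilReflect g)) x‖) / (1 + η) =
      16 * R / (1 + η) * (∫ t, ‖g t‖ ^ 2) +
        1 / (4 * (1 + η)) * ∫ x in Ioi (0 : ℝ), ‖weilSymm (weilConv g (weilReflect g)) x‖ := by
    field_simp
  rw [e]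
  constructor <;> linarith [hP.1, hP.2, hRes'.1, hRes'.2]

end Dilates

end Summit.RiemannHypothesis.RiemannHypothesis.Theorems.MotivicDoor.ConnesConsani
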